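/-
Copyright (c) 2026. All rights reserved.
Released under Apache 2.0 license as described in the file LICENSE.
Authors: abc-iut cell — Lemma 4.3 schema / Lemma 4.4 drafted by seat abc-iut-L4-t2 (wave 1);
Def 4.1 (iii), Lemma 4.3 (M)-shape, records, adoption and filing by seat abc-iut-L4-t14 (wave 2, block
W2-B16, L4 ruling ρ handover: announced names kept).
-/
import Literature.AnabelianGeometry.AbsoluteAnabelian.ArchimedeanLogFrobenius
import Mathlib.Analysis.SpecialFunctions.Complex.Log
import Mathlib.Analysis.Complex.Circle
import Literature.AnabelianGeometry.AbsoluteAnabelian.AbsTopIII.CurveModel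
import Literature.AlgebraicGeometry.Frobenioids.Categories
import HarnessLib

/-!
# Archimedean log-Frobenius compatibility, II: the natural functors, the log-Frobenius operation and
# pre-log-shell, `LinHol`, slimness, add/mult distinguishability ([AbsTopIII] §4: Def 4.1 (iii), (iv), (v);
# Prop 4.2 (ii); Rmk 4.1.1, 4.1.2; Lemma 4.3; Lemma 4.4)

Statements-first typing (D-0014) of S. Mochizuki, *Topics in absolute anabelian geometry III*, §4
pp.102–107 (bib key `MochizukiAbsTopIII2015`; locators = kurims manuscript pages, lit key
`paper:url-5493eb38cbb7`, read on the page), over the vocabulary of `ArchimedeanLogFrobenius.lean`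
(`ModelAutHolPair`, `AutHolPair`, `AutHolPair.Iso`/`Hom`, `IsAutHolPair`); the Def 4.1 (iv)/(v) items,
Prop 4.2 and Lemma 4.3 (schema)/4.4 were drafted by abc-iut-L4-t2 and are adopted under L4 ruling ρ.

* Def 4.1 (iii) pp.102–103 — OBJECT-LEVEL content as real definitions: "since the formation of `𝒪_k^⊳`
  (respectively, `k^×`; `𝒪_k^×`; `𝒪_k^×`) from `k` (respectively, `𝒪_k^⊳`; `𝒪_k^⊳`; `k^×`) is clearly
  intrinsically defined … we thus obtain natural functors `𝒞^hol_TF → 𝒞^hol_TM`; `𝒞^hol_TM → 𝒞^hol_TLG`;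
  `𝒞^hol_TM → 𝒞^hol_TCG`; `𝒞^hol_TLG → 𝒞^hol_TCG`": on model data the pair keeps `(k, 𝕏_ell, κ_k)` and
  only the arithmetic data `M_k ⊆ k` changes (`ModelAutHolPair.ofType` = raw index change between any
  algebraic types; the printed four arrows and their composites = `ArchPairType.IsNaturalArrow`,
  `ModelAutHolPair.natural`; the chain `𝒪_k^× ⊆ 𝒪_k^⊳ ⊆ k^× ⊆ k` PROVED, `archData_chain`); "the assignment `(𝕏 ↶ M) ↦ 𝕏` determines …
  natural functors `𝒞^hol_T → EA`" (`AutHolPair.toStructure`, `AutHolPair.Hom.toStructure`).  NOT typed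
  here (recorded): the packaging of `𝒞^hol_T`, of its subcategories `𝒞̲^hol_T` / `𝒞̲̲^hol_T` /
  (isomorphisms) determined by the `T`-isomorphisms / structure-isomorphisms / isomorphisms, of the full
  subcategories `𝒞^{hol-sB}_T` ("of strictly Belyi type"), and of `TH ⊇ EA ⊇ EA_sB` as Mathlib
  categories — composition of finite étale morphisms of orbispace presentations is not available, and
  "arises from an elliptically admissible hyperbolic orbicurve [of strictly Belyi type] over a CAF" is
  the campaign's `CurveModel`-relative hypothesis (L4 typing policy θ);
* Def 4.1 (iv) pp.103–105 — the archimedean log-Frobenius OPERATION `k ↦ k~` (field structure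
  transported by `log_k`; with `k~ := (k,+)` and `log_k = id` it is literally the identity on model
  `TF`-pairs: `logFrobeniusTF`), the covering `k~ ↠ k^×` as a DEFINITION (`ArchLogFrobeniusOutput.cover`,
  audit A21-F2), and the **pre-log-shell** = the "subquotient compactum" `𝒪_k^× ⊆ k^×` (REAL: the unit
  circle, compact — `archPreLogShell`, `isCompact_archPreLogShell`);
* Def 4.1 (v) p.105 — `LinHol` objects `(𝕏, 𝕏 ↶ 𝒜_𝕏)` (tautological Kummer structure, `linHolPair`);
* Prop 4.2 (ii) pp.105–106 — "`𝔩𝔬𝔤_{T,T}` is isomorphic to the identity functor": NOT typed as the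
  printed natural isomorphism (the categories are not packaged); object-level shadow only:
  `logFrobeniusTF_pair` (`rfl` in this realisation) and `ModelAutHolPair.ofType` for the 1-factorisation
  `𝒞^hol_TF → 𝒞^hol_TM → 𝒞^hol_T`; Prop 4.2 (i) (not typed — needs Cor 2.7 functoriality) and Rmk 4.2.1 are
  discussed in `ArchimedeanLogFrobenius.lean`;
* Rmk 4.1.1 p.105 — RECORDED: "the topological monoid `𝒪_k^⊳` associated to a CAF `k` is essentially
  the data used to construct the archimedean Frobenioids of [Mzk17], Example 3.3, (ii)" (= [FrdII]
  Ex 3.3, layer L1 of the cell, `Literature.AlgebraicGeometry.Frobenioids`);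
* Rmk 4.1.2 p.105 — RECORDED (scope): requiring the structure-orbispace to be elliptically admissible
  and the base field to be a CAF is a simplification; generalisations to more general hyperbolic
  orbicurves [cf. Props 2.5, 2.6; Rmk 2.6.1] over arbitrary archimedean fields "are beyond the scope of
  the present paper";
* Lemma 4.3 p.106 (slimness of archimedean `Π_X`, "well-known") — in the campaign's (M)-shape over
  abc-iut-L4-t1's `CurveModel` (`Lem_4_3`: for every hyperbolic orbicurve of the model whose base field
  is field-isomorphic to `ℝ` or `ℂ`, `Π` is slim — slimness = the tree's `IsSlimGroup`); the
  draft's free-predicate schema `ArchimedeanPiSlim` is NOT filed (review: a cited schema over free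
  predicates carries no content of the lemma);
* Lemma 4.4 p.107 — PROVED for `k = ℂ` (`addMulDistinguishableArch`, abc-iut-L4-t2): no composite
  `k^× →α (k~)^× ↪ k~ ↠ k^×` with `α` a topological group isomorphism is bijective.

Refereed pre-IUT anabelian geometry; nothing here bears on the disputed [IUTchIII] Cor. 3.12; named
facts are quoted, not asserted; typed ≠ discharged except where a proof is given.
-/

namespace Literature.AnabelianGeometry.AbsoluteAnabelian

open _root_.TopologicalSpace _root_.Topology
open Literature.AlgebraicGeometry.Frobenioids (IsSlimGroup)

universe u

noncomputable section

/-! ### Definition 4.1 (iii): the natural functors, object level -/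

/-- **Def 4.1 (iii), type-index change of model data** (a superset of the natural functors, see
below): "since the formation of `𝒪_k^⊳` (respectively,
`k^×`; `𝒪_k^×`; `𝒪_k^×`) from `k` (respectively, `𝒪_k^⊳`; `𝒪_k^⊳`; `k^×`) is clearly intrinsically defined
[i.e., depends only on the 'input data of an object of `T`'], we thus obtain natural functors
`𝒞^hol_TF → 𝒞^hol_TM`; `𝒞^hol_TM → 𝒞^hol_TLG`; `𝒞^hol_TM → 𝒞^hol_TCG`; `𝒞^hol_TLG → 𝒞^hol_TCG`" — on
MODEL data the functor keeps `(k, 𝕏_ell, 𝒜_𝕏, κ_k)` and changes only the type index, i.e. which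
subset `M_k ⊆ k` (`ModelAutHolPair.arithData`) is the arithmetic datum.  THIS DEF is the raw
type-index change of model data between ANY two algebraic types — a superset of the natural functors:
only the four printed arrows `TF → TM`, `TM → TLG`, `TM → TCG`, `TLG → TCG` (and their composites,
`ArchPairType.IsNaturalArrow`, `ModelAutHolPair.natural` below) are functors on PAIRS, since e.g.
`𝒪_k^×` does not determine `k` intrinsically; on model data the index change is available in every
direction only because the model carries `k`.
[cite: MochizukiAbsTopIII2015, Definition 4.1 (iii) p.103] -/
def ModelAutHolPair.ofType {T : ArchPairType} (P : ModelAutHolPair.{u} T) (T' : ArchPairType)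
    (h : T'.IsAlgebraic) : ModelAutHolPair.{u} T' where
  k := P.k
  isCAF := P.isCAF
  X := P.X
  L := P.L
  A := P.A
  κ := P.κ
  algebraic := h

/-- Changing the type does not change the base CAF. [cite: MochizukiAbsTopIII2015, Definition 4.1 (iii) p.103] -/
@[simp] theorem ModelAutHolPair.ofType_k {T : ArchPairType} (P : ModelAutHolPair.{u} T)
    (T' : ArchPairType) (h : T'.IsAlgebraic) : (P.ofType T' h).k = P.k := rfl

/-- Position of a type in the chain of printed natural functors `TF → TM → TLG → TCG` (`TM → TCG` is also
printed; the non-algebraic types `TH`, `TH⊞` are placed last and excluded by `IsNaturalArrow`).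
[cite: MochizukiAbsTopIII2015, Definition 4.1 (iii) p.103] -/
def ArchPairType.rank : ArchPairType → ℕ
  | .TF => 0
  | .TM => 1
  | .TLG => 2
  | .TCG => 3
  | .TH => 4
  | .THadd => 4

/-- **Def 4.1 (iii): the natural arrows between algebraic types** — the four printed functors
`𝒞^hol_TF → 𝒞^hol_TM`, `𝒞^hol_TM → 𝒞^hol_TLG`, `𝒞^hol_TM → 𝒞^hol_TCG`, `𝒞^hol_TLG → 𝒞^hol_TCG` and
their composites (with identities): exactly the pairs `T ≤ T'` in the chain `TF < TM < TLG < TCG` of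
algebraic types. [cite: MochizukiAbsTopIII2015, Definition 4.1 (iii) p.103] -/
def ArchPairType.IsNaturalArrow (T T' : ArchPairType) : Prop :=
  T.IsAlgebraic ∧ T'.IsAlgebraic ∧ T.rank ≤ T'.rank

/-- The four printed arrows are natural arrows. [cite: MochizukiAbsTopIII2015, Definition 4.1 (iii) p.103] -/
theorem ArchPairType.isNaturalArrow_printed :
    ArchPairType.IsNaturalArrow .TF .TM ∧ ArchPairType.IsNaturalArrow .TM .TLG ∧
      ArchPairType.IsNaturalArrow .TM .TCG ∧ ArchPairType.IsNaturalArrow .TLG .TCG := by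
  refine ⟨⟨?_, ?_, ?_⟩, ⟨?_, ?_, ?_⟩, ⟨?_, ?_, ?_⟩, ⟨?_, ?_, ?_⟩⟩ <;>
    simp [ArchPairType.rank, ArchPairType.IsAlgebraic]

/-- There is no natural arrow out of `TCG` to `TF` (`𝒪_k^×` does not determine `k`): the predicate
excludes the non-printed directions. [cite: MochizukiAbsTopIII2015, Definition 4.1 (iii) p.103] -/
theorem ArchPairType.not_isNaturalArrow_TCG_TF : ¬ ArchPairType.IsNaturalArrow .TCG .TF := by
  rintro ⟨-, -, h⟩
  simp [ArchPairType.rank] at h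

/-- **Def 4.1 (iii): the natural functors on (model) objects** — the type change of model data ALONG A
NATURAL ARROW `T → T'`. [cite: MochizukiAbsTopIII2015, Definition 4.1 (iii) p.103] -/
def ModelAutHolPair.natural {T : ArchPairType} (P : ModelAutHolPair.{u} T) (T' : ArchPairType)
    (h : ArchPairType.IsNaturalArrow T T') : ModelAutHolPair.{u} T' :=
  P.ofType T' h.2.1

/-- `natural` is the index change `ofType` restricted to natural arrows.
[cite: MochizukiAbsTopIII2015, Definition 4.1 (iii) p.103] -/
@[simp] theorem ModelAutHolPair.natural_eq_ofType {T : ArchPairType} (P : ModelAutHolPair.{u} T)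
    (T' : ArchPairType) (h : ArchPairType.IsNaturalArrow T T') : P.natural T' h = P.ofType T' h.2.1 := rfl

/-- The arithmetic data along the natural functors form the chain `𝒪_k^× ⊆ 𝒪_k^⊳ ⊆ k^× ⊆ k` inside
the CAF `k` (the functors `TM → TCG`, `TLG → TCG` take "the subgroup of invertible elements" /
"the maximal compact subgroup", `TF → TM` "the multiplicative monoid of nonzero elements of absolute
value `≤ 1`", `TM → TLG` "the associated groupification").  PROVED set inclusions.
[cite: MochizukiAbsTopIII2015, Definition 4.1 (iii) p.103] -/
theorem archData_chain (k : Type u) [NormedField k] :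
    {x : k | ‖x‖ = 1} ⊆ {x : k | x ≠ 0 ∧ ‖x‖ ≤ 1} ∧
      {x : k | x ≠ 0 ∧ ‖x‖ ≤ 1} ⊆ {x : k | x ≠ 0} ∧ {x : k | x ≠ 0} ⊆ (Set.univ : Set k) := by
  refine ⟨fun x hx => ⟨?_, le_of_eq hx⟩, fun x hx => hx.1, fun _ _ => Set.mem_univ _⟩
  intro h0
  rw [Set.mem_setOf_eq, h0, norm_zero] at hx
  exact zero_ne_one hx

/-- The same chain read on a model pair of type `TCG`: its arithmetic data `𝒪_k^×` lies in the
arithmetic data `𝒪_k^⊳` of the associated `TM`-pair, which lies in that (`k^×`) of the `TLG`-pair.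
[cite: MochizukiAbsTopIII2015, Definition 4.1 (iii) p.103] -/
theorem ModelAutHolPair.arithData_subset_ofType (P : ModelAutHolPair.{u} .TCG) :
    P.arithData ⊆ (P.ofType .TM ⟨by decide, by decide⟩).arithData ∧
      (P.ofType .TM ⟨by decide, by decide⟩).arithData ⊆
        (P.ofType .TLG ⟨by decide, by decide⟩).arithData :=
  ⟨(archData_chain P.k).1, (archData_chain P.k).2.1⟩

/-- **Def 4.1 (iii), the bracketed intrinsic description of `𝒪_k^⊳`**: the functor `𝒞^hol_TF → 𝒞^hol_TM`
takes "the multiplicative monoid of nonzero elements of absolute value `≤ 1` of the arithmetic data [i.e.,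
nonzero elements of the closure of the set of elements `a` such that `a^n → 0` as `n → ∞`]" — PROVED
for a normed field that is a normed `ℝ`-algebra (every CAF or RAF with its absolute value): the
description uses only the topological field `k`, not the chosen norm.
[cite: MochizukiAbsTopIII2015, Definition 4.1 (iii) p.103] -/
theorem nonzeroIntegers_eq_closure_powTendstoZero (k : Type u) [NormedField k] [NormedSpace ℝ k] :
    {x : k | x ≠ 0 ∧ ‖x‖ ≤ 1} =
      closure {a : k | Filter.Tendsto (fun n : ℕ => a ^ n) Filter.atTop (nhds 0)} \ {0} := by
  have hset : {a : k | Filter.Tendsto (fun n : ℕ => a ^ n) Filter.atTop (nhds 0)} =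
      Metric.ball (0 : k) 1 := by
    ext a
    simp only [Set.mem_setOf_eq, Metric.mem_ball, dist_zero_right]
    exact tendsto_pow_atTop_nhds_zero_iff_norm_lt_one
  rw [hset, closure_ball (0 : k) one_ne_zero]
  ext x
  simp only [Set.mem_setOf_eq, Set.mem_sdiff, Metric.mem_closedBall, dist_zero_right,
    Set.mem_singleton_iff]
  tauto

/-- **Def 4.1 (iii)**: "the assignment `(𝕏 ↶ M) ↦ 𝕏` determines various compatible natural functors
`𝒞^hol_T → EA`" — on objects: the structure-orbispace. [cite: MochizukiAbsTopIII2015, Definition 4.1 (iii) p.103] -/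
def AutHolPair.toStructure (P : AutHolPair.{u}) : AutHolOrbiPresentation.{u} := P.X

/-- … and on morphisms: the finite étale morphism `φ_𝕏` of presenting spaces underlying a morphism of
pairs (a morphism of the Aut-holomorphic structures, by `AutHolPair.Hom.isMorphism`).
[cite: MochizukiAbsTopIII2015, Definition 4.1 (iii) p.103] -/
def AutHolPair.Hom.toStructure {P Q : AutHolPair.{u}} (φ : P.Hom Q) : P.X.U → Q.X.U := φ.homU

/-! ### Definition 4.1 (iv): the archimedean log-Frobenius operation and pre-log-shell -/

/-- **Def 4.1 (iv): the log-Frobenius operation on model `TF`-pairs.**  "The field structure of `k`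
determines, via the inverse morphism to `log_k`, a structure of topological field on the topological
group `k~`; moreover, `κ_k` determines a `k~`-Kummer structure on `𝕏_ell`, `κ_{k~} : k~ ⥲ 𝒜_𝕏_ell`",
characterised by compatibility of co-holomorphicizations with `k~ ↠ k^× ↪ k`; the assignment
`(k, κ_k) ↦ (k~, κ_{k~})` is the functor `𝔩𝔬𝔤_{TF,TF}`, "isomorphic to the identity functor".  With
`k~` realised as `(k, +)` and `log_k = id` (Def 4.1 (i) above), the output model pair has the SAME
field and Kummer structure; what the operation adds is the covering `k~ ↠ k^×` as extra datum.
[cite: MochizukiAbsTopIII2015, Definition 4.1 (iv) pp.103–104] -/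
structure ArchLogFrobeniusOutput : Type (u + 1) where
  /-- The input (= output) model `TF`-pair. -/
  pair : ModelAutHolPair.{u} .TF
  [charZero : CharZero pair.k]

attribute [instance] ArchLogFrobeniusOutput.charZero

/-- The universal covering `k~ = (k,+) ↠ k^×`, `x ↦ exp x`, of the log-Frobenius output (a
DEFINITION, not a field: the covering is determined by `k` — audit A21-F2).
[cite: MochizukiAbsTopIII2015, Definition 4.1 (iv) pp.103–104] -/
def ArchLogFrobeniusOutput.cover (O : ArchLogFrobeniusOutput.{u}) : O.pair.k → O.pair.k :=
  univCover O.pair.k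

/-- **Def 4.1 (iv) / Prop 4.2 (ii): the log-Frobenius functor `𝔩𝔬𝔤_{TF,TF}` on model data.**  With
`k~ := (k,+)` and `log_k = id` (Def 4.1 (i) above) the assignment `(k, κ_k) ↦ (k~, κ_{k~})` is literally
the identity on model `TF`-pairs; the output carries the covering `k~ ↠ k^×` (`ArchLogFrobeniusOutput.cover`).
[cite: MochizukiAbsTopIII2015, Definition 4.1 (iv) p.104] -/
def logFrobeniusTF (P : ModelAutHolPair.{u} .TF) [CharZero P.k] : ArchLogFrobeniusOutput.{u} where
  pair := P

/-- Toward **Prop 4.2 (ii)** ("the functor `𝔩𝔬𝔤_{T,T}` is isomorphic to the identity functor", `T = TF`):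
in this realisation the underlying model pair of `𝔩𝔬𝔤_{TF,TF}(P)` IS `P` (`rfl`).  The printed statement
is a natural isomorphism of endofunctors of the category `𝒞^hol_TF` together with the 1-factorisation
`𝒞^hol_TF → 𝒞^hol_TM → 𝒞^hol_T`; since the categories `𝒞^hol_T` are not packaged here (Def 4.1 (iii)
note), Prop 4.2 (ii) is NOT typed as such — this lemma and `ModelAutHolPair.ofType` are its object-level
shadow. [cite: MochizukiAbsTopIII2015, Proposition 4.2 (ii) pp.105–106] -/
theorem logFrobeniusTF_pair (P : ModelAutHolPair.{u} .TF) [CharZero P.k] :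
    (logFrobeniusTF P).pair = P := rfl

/-- **Def 4.1 (iv): the pre-log-shell** — "the fields `k~` … are equipped with a natural 'subquotient
compactum' — i.e., the compact subset `𝒪_k^× ⊆ k^×` that lies in the natural quotient `k~ ↠ k^×` —
which we shall refer to as the pre-log-shell".  REAL: the image of the parent's `𝒪_k^× = archUnits k`
under `k^× ↪ k` (the target of the covering `k~ ↠ k^× ⊆ k`).
[cite: MochizukiAbsTopIII2015, Definition 4.1 (iv) pp.104–105] -/
def archPreLogShell (k : Type u) [NormedField k] : Set k := ((↑) : kˣ → k) '' (archUnits k : Set kˣ)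

/-- The pre-log-shell is the unit sphere of `k`. [cite: MochizukiAbsTopIII2015, Definition 4.1 (iv) pp.104–105] -/
theorem archPreLogShell_eq_sphere (k : Type u) [NormedField k] :
    archPreLogShell k = Metric.sphere (0 : k) 1 := by
  ext x
  simp only [archPreLogShell, Set.mem_image, SetLike.mem_coe, Metric.mem_sphere, dist_zero_right]
  constructor
  · rintro ⟨u, hu, rfl⟩
    exact hu
  · intro hx
    have hx0 : x ≠ 0 := by
      rintro rfl
      simp at hx
    exact ⟨Units.mk0 x hx0, hx, rfl⟩

/-- The archimedean pre-log-shell is compact (for a CAF, indeed for any proper normed field).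
[cite: MochizukiAbsTopIII2015, Definition 4.1 (iv) pp.104–105] -/
theorem isCompact_archPreLogShell (k : Type u) [NormedField k] [ProperSpace k] :
    IsCompact (archPreLogShell k) := by
  rw [archPreLogShell_eq_sphere]
  exact isCompact_sphere 0 1

/-! ### Definition 4.1 (v): `LinHol` -/

/-- **Def 4.1 (v): an object of `LinHol`** — a pair `(𝕏, 𝕏 ↶^κ 𝒜_𝕏)` "consisting of an object
`𝕏 ∈ Ob(EA)`, together with the tautological Kummer map `𝒜_𝕏 ⥲ 𝒜_𝕏` [i.e., given by the identity]" —
the Aut-holomorphic `TF`-type pair with arithmetic data `𝒜_𝕏` itself.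
[cite: MochizukiAbsTopIII2015, Definition 4.1 (v) p.105] -/
def linHolPair (X : AutHolOrbiPresentation.{u}) (L : LocalLinearHolStructure X.U) (A : LinHolField L) :
    AutHolPair.{u} where
  X := X
  L := L
  A := A
  M := A.F
  κM := MonoidHom.id _
  continuous_κM := continuous_id

/-! ### Lemma 4.3, Lemma 4.4 -/

/-- **Lemma 4.3** (Slimness of Archimedean Fundamental Groups): "let `X` be a hyperbolic orbicurve over an
archimedean field `k_X`.  Then the étale fundamental group `Π_X` of `X` is slim" — in the campaign's
(M)-shape (L4 typing policy θ) over abc-iut-L4-t1's `CurveModel`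
(whose `Curve` indexes hyperbolic orbicurves over fields of characteristic zero with their extensions
`1 → Δ_U → Π_U → G_k → 1`): for every hyperbolic orbicurve `U` of the model whose base field `k` is an
archimedean field — typed as: `k` is field-isomorphic to `ℂ` or to `ℝ` (the étale fundamental group
does not see the topology of `k`) — "the étale fundamental group `Π_X` of `X` is slim" (slim = the
tree's `IsSlimGroup`: every open subgroup has trivial centraliser).  Named `Prop` fact relative to `M`.
[cite: MochizukiAbsTopIII2015, Lemma 4.3 p.106] -/
def Lem_4_3 (M : AbsTopIII.CurveModel.{u}) : Prop :=
  ∀ U : M.Curve, (Nonempty (M.base U ≃+* ℂ) ∨ Nonempty (M.base U ≃+* ℝ)) →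
    IsSlimGroup (M.ext U).arith

/-- **Lemma 4.4** (Topological Distinguishability of Additive and Multiplicative Structures,
archimedean): for a CAF `k`, "no composite of the form `k^× →α (k~)^× ↪ k~ ↠ k^×` — where the `×` of
`(k~)^×` is relative to the field structure of `k~`; `α` is an isomorphism of topological groups;
`↪` is the natural inclusion; `↠` is the natural map — is bijective".  With `k~ = (k,+)`, field
structure = that of `k`, and `k~ ↠ k^×` the exponential (codomain `k^×`, as printed); stated for
`k = ℂ`.
[cite: MochizukiAbsTopIII2015, Lemma 4.4 p.107] -/
def AddMulDistinguishableArch : Prop :=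
  ∀ α : ℂˣ ≃ₜ* ℂˣ,
    ¬ Function.Bijective (fun z : ℂˣ => Units.mk0 (Complex.exp ((α z : ℂˣ) : ℂ)) (Complex.exp_ne_zero _))

/-- Lemma 4.4 holds: "the non-injectivity of `k~ ↠ k^×` implies that the composite under
consideration fails to be injective" (`exp(2πi) = exp(4πi)`).
[cite: MochizukiAbsTopIII2015, Lemma 4.4 p.107] -/
theorem addMulDistinguishableArch : AddMulDistinguishableArch := by
  intro α hbij
  have hinj := hbij.1
  -- two distinct nonzero complex numbers with the same exponential
  set a : ℂ := 2 * Real.pi * Complex.I with ha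
  have ha0 : a ≠ 0 := by
    simp [ha, Complex.ext_iff, Real.pi_ne_zero]
  have h2a0 : 2 * a ≠ 0 := mul_ne_zero two_ne_zero ha0
  obtain ⟨z₁, hz₁⟩ := α.surjective (Units.mk0 a ha0)
  obtain ⟨z₂, hz₂⟩ := α.surjective (Units.mk0 (2 * a) h2a0)
  have hexp : Complex.exp ((α z₁ : ℂˣ) : ℂ) = Complex.exp ((α z₂ : ℂˣ) : ℂ) := by
    rw [hz₁, hz₂, Units.val_mk0, Units.val_mk0, ha]
    rw [Complex.exp_eq_one_iff.mpr ⟨1, by simp⟩]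
    rw [Complex.exp_eq_one_iff.mpr ⟨2, by push_cast; ring⟩]
  have hz : z₁ = z₂ := hinj (by ext; simpa using hexp)
  have : (Units.mk0 a ha0 : ℂˣ) = Units.mk0 (2 * a) h2a0 := by rw [← hz₁, ← hz₂, hz]
  have : a = 2 * a := by simpa using congrArg Units.val this
  exact ha0 (by linear_combination -this)

end

end Literature.AnabelianGeometry.AbsoluteAnabelian

/-! ## `_holds` aliases (appended 2026-08-28)

The named fact(s) below are already theorems of the tree under another name; the `_holds`
alias records the discharge under the tree's naming convention (D-0026 bookkeeping: proof term =
the existing theorem, no statement or definition edited). -/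

/-- `AddMulDistinguishableArch` is a theorem of the tree (`Literature.AnabelianGeometry.AbsoluteAnabelian.addMulDistinguishableArch`). [cite: MochizukiAbsTopIII2015, Lemma 4.4 p.107] -/
theorem _root_.Literature.AnabelianGeometry.AbsoluteAnabelian.AddMulDistinguishableArch_holds : _root_.Literature.AnabelianGeometry.AbsoluteAnabelian.AddMulDistinguishableArch :=
  _root_.Literature.AnabelianGeometry.AbsoluteAnabelian.addMulDistinguishableArch
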